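import Mathlib

/-!
# LINE `valuative_door` (crux `WeakLifting`, stmt-ValiantsHypothesis-19561) — arithmetic core of the SHARPNESS of the `m = 2` Sidon law
# `npEdges ≤ 3K − 4`: the tropical inequalities of the extremal family `d_i = 2^i`, `ord a_i = (16i+20)2^i`, `ord b_i = (16i+9)2^i`,
# `ord c_i = 16i·2^i + 1`

HONEST FRAMING.  Helper (cell `pub-symmetroid`, seat val-sym-lift-p1 g23, 2026-08-29; `--supports 19561 --as helper`).  Pure `ℕ`-arithmetic for
the sequel `…ValuativeDoorSidonTwoSharp` (the `3K − 4` of `…ValuativeDoorSidonTwo.valSidonTwo_unfolded` is attained for every `K`): for the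
symmetric `2 × 2` letters `S_i = [[π^{A_i}, π^{B_i}], [π^{B_i}, π^{C_i}]]`, `A_i = (16i+20)2^i`, `B_i = (16i+9)2^i`, `C_i = 16i·2^i + 1` on the
Sidon support `d_i = 2^i` (`two_pow_sidon`), the `3K − 3` BAND exponents are dominant at the integer slopes `(k,k) ↦ 16k+32`,
`(k,k+1) ↦ 16k+44`, `(k,k+2) ↦ 16k+51`; dominance of the target `(n, E)` at slope `s` against a competitor term `(e, E')` is the
inequality `n + s·E' < e + s·E`, and each such inequality splits into two one-letter bounds of the shape
`(16k + c₁)·2^p ≤ (16p + c₀)·2^p + c₂·2^k` (`oneLetter_le` / `oneLetter_lt`, two branches `p ≥ k` / `p ≤ k`).  The six assembled families are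
`diag_vs_bb`, `diag_vs_ac`, `adj_vs_bb`, `adj_vs_ac`, `skip_vs_bb`, `skip_vs_ac`.  Design (located, `exp/family2.py`, K = 2..29): Gauss-norm
picture `‖det‖ = max(‖α‖‖γ‖, ‖β‖²)` with breakpoints `σ_j = 16j+16` (γ), `ρ_i = 16i+36` (α, lagging), `ν_k = 16k+25` (β); the `K − 2` interior
diagonals are `‖β‖²`-windows.  Calibration arithmetic only; no bearing on vW / vB, `TropicalB`, `MatrixDescartes` (18050) or VP ≠ VNP.
[elementary]
-/

set_option linter.dupNamespace false
set_option autoImplicit false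

namespace Summit.ValiantsHypothesis.ValiantsHypothesis.Theorems.KPlusLogSqLaw.ValDoor

/-! ## §1 Powers of two form a Sidon set -/

/-- `2^a + 2^b = 2^c + 2^e` forces `{a, b} = {c, e}`. [elementary: binary digits] -/
theorem two_pow_sidon (a b c e : ℕ) (h : 2 ^ a + 2 ^ b = 2 ^ c + 2 ^ e) : (a = c ∧ b = e) ∨ (a = e ∧ b = c) := by
  -- the smaller exponent on each side is the 2-adic valuation unless the two are equal
  have key : ∀ a b c e : ℕ, a ≤ b → c ≤ e → 2 ^ a + 2 ^ b = 2 ^ c + 2 ^ e → a = c ∧ b = e := by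
    intro a b c e hab hce h
    have hpow : ∀ {x y : ℕ}, x < y → 2 ^ (x + 1) ∣ 2 ^ y := fun {x y} hxy => Nat.pow_dvd_pow 2 hxy
    -- first a = c
    have hac : a = c := by
      by_contra hne
      rcases Nat.lt_or_gt_of_ne hne with hlt | hlt
      · -- a < c ≤ e: RHS divisible by 2^(a+1)
        have h1 : 2 ^ (a + 1) ∣ 2 ^ c + 2 ^ e := dvd_add (hpow hlt) (hpow (hlt.trans_le hce))
        rw [← h] at h1
        rcases eq_or_lt_of_le hab with heq | hlt'
        · rw [← heq, ← two_mul, ← pow_succ'] at h1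
          -- 2^(a+1) ∣ 2^(a+1): fine, but then 2^(a+1) = 2^c + 2^e ≥ 2^(a+1) + 2^(a+1)
          have h2 : 2 ^ (a + 1) ≤ 2 ^ c := Nat.pow_le_pow_right (by norm_num) hlt
          have h3 : 2 ^ (a + 1) ≤ 2 ^ e := Nat.pow_le_pow_right (by norm_num) (hlt.trans_le hce)
          have h4 : 2 ^ a + 2 ^ b = 2 ^ (a + 1) := by rw [← heq, ← two_mul, ← pow_succ']
          omega
        · have h2 : 2 ^ (a + 1) ∣ 2 ^ b := hpow hlt'
          have h3 : 2 ^ (a + 1) ∣ 2 ^ a := (Nat.dvd_add_left h2).1 h1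
          have h4 : 2 ^ (a + 1) ≤ 2 ^ a := Nat.le_of_dvd (Nat.two_pow_pos a) h3
          have h5 : 2 ^ a < 2 ^ (a + 1) := Nat.pow_lt_pow_right (by norm_num) (Nat.lt_succ_self a)
          omega
      · -- c < a ≤ b: symmetric
        have h1 : 2 ^ (c + 1) ∣ 2 ^ a + 2 ^ b := dvd_add (hpow hlt) (hpow (hlt.trans_le hab))
        rw [h] at h1
        rcases eq_or_lt_of_le hce with heq | hlt'
        · have h2 : 2 ^ (c + 1) ≤ 2 ^ a := Nat.pow_le_pow_right (by norm_num) hlt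
          have h3 : 2 ^ (c + 1) ≤ 2 ^ b := Nat.pow_le_pow_right (by norm_num) (hlt.trans_le hab)
          have h4 : 2 ^ c + 2 ^ e = 2 ^ (c + 1) := by rw [← heq, ← two_mul, ← pow_succ']
          omega
        · have h2 : 2 ^ (c + 1) ∣ 2 ^ e := hpow hlt'
          have h3 : 2 ^ (c + 1) ∣ 2 ^ c := (Nat.dvd_add_left h2).1 h1
          have h4 : 2 ^ (c + 1) ≤ 2 ^ c := Nat.le_of_dvd (Nat.two_pow_pos c) h3
          have h5 : 2 ^ c < 2 ^ (c + 1) := Nat.pow_lt_pow_right (by norm_num) (Nat.lt_succ_self c)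
          omega
    subst hac
    refine ⟨rfl, ?_⟩
    have h2 : 2 ^ b = 2 ^ e := by omega
    exact Nat.pow_right_injective le_rfl h2
  rcases le_total a b with hab | hba <;> rcases le_total c e with hce | hec
  · exact Or.inl (key a b c e hab hce h)
  · have := key a b e c hab hec (by rw [h, Nat.add_comm])
    exact Or.inr this
  · have := key b a c e hba hce (by rw [← h, Nat.add_comm])
    exact Or.inr ⟨this.2, this.1⟩
  · have := key b a e c hba hec (by rw [Nat.add_comm, h, Nat.add_comm])
    exact Or.inl ⟨this.2, this.1⟩

/-! ## §2 The generic two-branch bound -/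

/-- **generic one-letter bound** `(16k + c₁)·2^p ≤ (16p + c₀)·2^p + c₂·2^k` from the two branch hypotheses (`p = k + t` and `k = p + t`).
[elementary] -/
theorem oneLetter_le (c₀ c₁ c₂ : ℕ) (h1 : ∀ t : ℕ, c₁ * 2 ^ t ≤ (16 * t + c₀) * 2 ^ t + c₂)
    (h2 : ∀ t : ℕ, 16 * t + c₁ ≤ c₀ + c₂ * 2 ^ t) (k p : ℕ) :
    (16 * k + c₁) * 2 ^ p ≤ (16 * p + c₀) * 2 ^ p + c₂ * 2 ^ k := by
  rcases le_total k p with hkp | hpk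
  · obtain ⟨t, rfl⟩ := Nat.exists_eq_add_of_le hkp
    have h := Nat.mul_le_mul_left (2 ^ k) (h1 t)
    rw [pow_add]
    have hk : 0 < 2 ^ k := Nat.two_pow_pos k
    nlinarith [h]
  · obtain ⟨t, rfl⟩ := Nat.exists_eq_add_of_le hpk
    have h := Nat.mul_le_mul_left (2 ^ p) (h2 t)
    rw [pow_add]
    nlinarith [h]

/-- **generic one-letter bound, strict off the touching index `p = k + t₀`.** [elementary] -/
theorem oneLetter_lt (c₀ c₁ c₂ t₀ : ℕ) (h1 : ∀ t : ℕ, t ≠ t₀ → c₁ * 2 ^ t < (16 * t + c₀) * 2 ^ t + c₂)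
    (h2 : ∀ t : ℕ, 1 ≤ t → 16 * t + c₁ < c₀ + c₂ * 2 ^ t) (k p : ℕ) (hp : p ≠ k + t₀) :
    (16 * k + c₁) * 2 ^ p < (16 * p + c₀) * 2 ^ p + c₂ * 2 ^ k := by
  rcases le_total k p with hkp | hpk
  · obtain ⟨t, rfl⟩ := Nat.exists_eq_add_of_le hkp
    have ht : t ≠ t₀ := fun h => hp (by rw [h])
    have h := Nat.mul_lt_mul_of_pos_left (h1 t ht) (Nat.two_pow_pos k)
    rw [pow_add]
    nlinarith [h]
  · obtain ⟨t, rfl⟩ := Nat.exists_eq_add_of_le hpk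
    rcases Nat.eq_zero_or_pos t with rfl | ht
    · have ht : (0 : ℕ) ≠ t₀ := fun h => hp (by omega)
      have h := Nat.mul_lt_mul_of_pos_left (h1 0 ht) (Nat.two_pow_pos p)
      simp only [pow_zero, mul_one, Nat.mul_zero, Nat.zero_add, Nat.add_zero] at h ⊢
      nlinarith [h]
    · have h := Nat.mul_lt_mul_of_pos_left (h2 t ht) (Nat.two_pow_pos p)
      rw [pow_add]
      nlinarith [h]

/-! ## §3 The nine one-letter instances -/

/-- U1: `B_k + s₁ 2^p ≤ B_p + s₁ 2^k` for `s₁ = 16k+32`, strict off `p = k`. -/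
theorem u1_le (k p : ℕ) : (16 * k + 32) * 2 ^ p ≤ (16 * p + 9) * 2 ^ p + 23 * 2 ^ k := by
  refine oneLetter_le 9 32 23 (fun t => ?_) (fun t => ?_) k p
  · by_cases ht : 2 ≤ t
    · have : 32 ≤ 16 * t + 9 := by omega
      nlinarith [Nat.mul_le_mul_right (2 ^ t) this]
    · interval_cases t <;> norm_num
  · have := Nat.lt_two_pow_self (n := t)
    nlinarith

/-- U1, strict form off `p = k`. -/
theorem u1_lt (k p : ℕ) (hp : p ≠ k) : (16 * k + 32) * 2 ^ p < (16 * p + 9) * 2 ^ p + 23 * 2 ^ k := by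
  refine oneLetter_lt 9 32 23 0 (fun t ht => ?_) (fun t ht => ?_) k p (by simpa using hp)
  · by_cases ht2 : 2 ≤ t
    · have : 32 < 16 * t + 9 := by omega
      nlinarith [Nat.mul_lt_mul_of_pos_right this (Nat.two_pow_pos t)]
    · interval_cases t
      · exact absurd rfl ht
      · norm_num
  · have := Nat.lt_two_pow_self (n := t)
    nlinarith

/-- U2: `s₁ 2^p ≤ A_p + 14·2^k`. -/
theorem u2_le (k p : ℕ) : (16 * k + 32) * 2 ^ p ≤ (16 * p + 20) * 2 ^ p + 14 * 2 ^ k := by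
  refine oneLetter_le 20 32 14 (fun t => ?_) (fun t => ?_) k p
  · by_cases ht : 1 ≤ t
    · have : 32 ≤ 16 * t + 20 := by omega
      nlinarith [Nat.mul_le_mul_right (2 ^ t) this]
    · interval_cases t; norm_num
  · rcases Nat.eq_zero_or_pos t with rfl | ht
    · norm_num
    · -- `2t ≤ 2^t` for `t ≥ 1`, from `t - 1 < 2^(t-1)` (cf. `Literature.NumberTheory.EllipticCurves.two_mul_le_two_pow`)
      obtain ⟨u, rfl⟩ := Nat.exists_eq_add_of_le' ht
      have := Nat.lt_two_pow_self (n := u)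
      rw [pow_succ]
      nlinarith

/-- U3: `s₁ 2^q ≤ 16q·2^q + 32·2^k`. -/
theorem u3_le (k q : ℕ) : (16 * k + 32) * 2 ^ q ≤ (16 * q + 0) * 2 ^ q + 32 * 2 ^ k := by
  refine oneLetter_le 0 32 32 (fun t => ?_) (fun t => ?_) k q
  · by_cases ht : 2 ≤ t
    · have : 32 ≤ 16 * t + 0 := by omega
      nlinarith [Nat.mul_le_mul_right (2 ^ t) this]
    · interval_cases t <;> norm_num
  · have := Nat.lt_two_pow_self (n := t)
    nlinarith

/-- U4: `s₂ 2^p ≤ B_p + 38·2^k` for `s₂ = 16k+44`. -/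
theorem u4_le (k p : ℕ) : (16 * k + 44) * 2 ^ p ≤ (16 * p + 9) * 2 ^ p + 38 * 2 ^ k := by
  refine oneLetter_le 9 44 38 (fun t => ?_) (fun t => ?_) k p
  · by_cases ht : 3 ≤ t
    · have : 44 ≤ 16 * t + 9 := by omega
      nlinarith [Nat.mul_le_mul_right (2 ^ t) this]
    · interval_cases t <;> norm_num
  · have := Nat.lt_two_pow_self (n := t)
    nlinarith

/-- U5: `s₂ 2^p ≤ A_p + 24·2^k`, strict off `p = k`. -/
theorem u5_le (k p : ℕ) : (16 * k + 44) * 2 ^ p ≤ (16 * p + 20) * 2 ^ p + 24 * 2 ^ k := by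
  refine oneLetter_le 20 44 24 (fun t => ?_) (fun t => ?_) k p
  · by_cases ht : 2 ≤ t
    · have : 44 ≤ 16 * t + 20 := by omega
      nlinarith [Nat.mul_le_mul_right (2 ^ t) this]
    · interval_cases t <;> norm_num
  · have := Nat.lt_two_pow_self (n := t)
    nlinarith

/-- U5, strict form off `p = k`. -/
theorem u5_lt (k p : ℕ) (hp : p ≠ k) : (16 * k + 44) * 2 ^ p < (16 * p + 20) * 2 ^ p + 24 * 2 ^ k := by
  refine oneLetter_lt 20 44 24 0 (fun t ht => ?_) (fun t ht => ?_) k p (by simpa using hp)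
  · by_cases ht2 : 2 ≤ t
    · have : 44 < 16 * t + 20 := by omega
      nlinarith [Nat.mul_lt_mul_of_pos_right this (Nat.two_pow_pos t)]
    · interval_cases t
      · exact absurd rfl ht
      · norm_num
  · have := Nat.lt_two_pow_self (n := t)
    nlinarith

/-- U6: `s₂ 2^q ≤ 16q·2^q + 56·2^k`, strict off `q = k + 1`. -/
theorem u6_le (k q : ℕ) : (16 * k + 44) * 2 ^ q ≤ (16 * q + 0) * 2 ^ q + 56 * 2 ^ k := by
  refine oneLetter_le 0 44 56 (fun t => ?_) (fun t => ?_) k q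
  · by_cases ht : 3 ≤ t
    · have : 44 ≤ 16 * t + 0 := by omega
      nlinarith [Nat.mul_le_mul_right (2 ^ t) this]
    · interval_cases t <;> norm_num
  · have := Nat.lt_two_pow_self (n := t)
    nlinarith

/-- U6, strict form off `q = k + 1`. -/
theorem u6_lt (k q : ℕ) (hq : q ≠ k + 1) : (16 * k + 44) * 2 ^ q < (16 * q + 0) * 2 ^ q + 56 * 2 ^ k := by
  refine oneLetter_lt 0 44 56 1 (fun t ht => ?_) (fun t ht => ?_) k q hq
  · by_cases ht2 : 3 ≤ t
    · have : 44 < 16 * t + 0 := by omega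
      nlinarith [Nat.mul_lt_mul_of_pos_right this (Nat.two_pow_pos t)]
    · interval_cases t
      · norm_num
      · exact absurd rfl ht
      · norm_num
  · have := Nat.lt_two_pow_self (n := t)
    nlinarith

/-- U7: `s₃ 2^p ≤ B_p + 52·2^j` for `s₃ = 16j+51`. -/
theorem u7_le (j p : ℕ) : (16 * j + 51) * 2 ^ p ≤ (16 * p + 9) * 2 ^ p + 52 * 2 ^ j := by
  refine oneLetter_le 9 51 52 (fun t => ?_) (fun t => ?_) j p
  · by_cases ht : 3 ≤ t
    · have : 51 ≤ 16 * t + 9 := by omega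
      nlinarith [Nat.mul_le_mul_right (2 ^ t) this]
    · interval_cases t <;> norm_num
  · have := Nat.lt_two_pow_self (n := t)
    nlinarith

/-- U8: `s₃ 2^p ≤ A_p + 31·2^j`, strict off `p = j`. -/
theorem u8_le (j p : ℕ) : (16 * j + 51) * 2 ^ p ≤ (16 * p + 20) * 2 ^ p + 31 * 2 ^ j := by
  refine oneLetter_le 20 51 31 (fun t => ?_) (fun t => ?_) j p
  · by_cases ht : 2 ≤ t
    · have : 51 ≤ 16 * t + 20 := by omega
      nlinarith [Nat.mul_le_mul_right (2 ^ t) this]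
    · interval_cases t <;> norm_num
  · have := Nat.lt_two_pow_self (n := t)
    nlinarith

/-- U8, strict form off `p = j`. -/
theorem u8_lt (j p : ℕ) (hp : p ≠ j) : (16 * j + 51) * 2 ^ p < (16 * p + 20) * 2 ^ p + 31 * 2 ^ j := by
  refine oneLetter_lt 20 51 31 0 (fun t ht => ?_) (fun t ht => ?_) j p (by simpa using hp)
  · by_cases ht2 : 2 ≤ t
    · have : 51 < 16 * t + 20 := by omega
      nlinarith [Nat.mul_lt_mul_of_pos_right this (Nat.two_pow_pos t)]
    · interval_cases t
      · exact absurd rfl ht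
      · norm_num
  · have := Nat.lt_two_pow_self (n := t)
    nlinarith

/-- U9: `s₃ 2^q ≤ 16q·2^q + 76·2^j`, strict off `q = j + 2`. -/
theorem u9_le (j q : ℕ) : (16 * j + 51) * 2 ^ q ≤ (16 * q + 0) * 2 ^ q + 76 * 2 ^ j := by
  refine oneLetter_le 0 51 76 (fun t => ?_) (fun t => ?_) j q
  · by_cases ht : 4 ≤ t
    · have : 51 ≤ 16 * t + 0 := by omega
      nlinarith [Nat.mul_le_mul_right (2 ^ t) this]
    · interval_cases t <;> norm_num
  · have := Nat.lt_two_pow_self (n := t)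
    nlinarith

/-- U9, strict form off `q = j + 2`. -/
theorem u9_lt (j q : ℕ) (hq : q ≠ j + 2) : (16 * j + 51) * 2 ^ q < (16 * q + 0) * 2 ^ q + 76 * 2 ^ j := by
  refine oneLetter_lt 0 51 76 2 (fun t ht => ?_) (fun t ht => ?_) j q hq
  · by_cases ht2 : 4 ≤ t
    · have : 51 < 16 * t + 0 := by omega
      nlinarith [Nat.mul_lt_mul_of_pos_right this (Nat.two_pow_pos t)]
    · interval_cases t
      · norm_num
      · norm_num
      · exact absurd rfl ht
      · norm_num
  · have := Nat.lt_two_pow_self (n := t)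
    nlinarith

/-! ## §4 The six dominance families (`n + s·E' < e + s·E`) -/

/-- **diagonal target `(k,k)` (slope `16k+32`, `n = 2B_k`, `E = 2·2^k`) beats every `b_p b_q` term except its own.** -/
theorem diag_vs_bb (k p q : ℕ) (h : ¬ (p = k ∧ q = k)) :
    2 * ((16 * k + 9) * 2 ^ k) + (16 * k + 32) * (2 ^ p + 2 ^ q)
      < (16 * p + 9) * 2 ^ p + (16 * q + 9) * 2 ^ q + (16 * k + 32) * (2 ^ k + 2 ^ k) := by
  by_cases hp : p = k
  · have hq : q ≠ k := fun hq => h ⟨hp, hq⟩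
    have h1 := u1_le k p
    have h2 := u1_lt k q hq
    nlinarith [h1, h2]
  · have h1 := u1_lt k p hp
    have h2 := u1_le k q
    nlinarith [h1, h2]

/-- **diagonal target `(k,k)` beats every `a_p c_q` term** (including its own `a_k c_k`). -/
theorem diag_vs_ac (k p q : ℕ) :
    2 * ((16 * k + 9) * 2 ^ k) + (16 * k + 32) * (2 ^ p + 2 ^ q)
      < (16 * p + 20) * 2 ^ p + (16 * q * 2 ^ q + 1) + (16 * k + 32) * (2 ^ k + 2 ^ k) := by
  have h1 := u2_le k p
  have h2 := u3_le k q
  nlinarith [h1, h2]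

/-- **adjacent target `(k,k+1)` (slope `16k+44`, `n = A_k + C_{k+1}`, `E = 2^k + 2^{k+1}`) beats every `b_p b_q` term.** -/
theorem adj_vs_bb (k p q : ℕ) :
    (16 * k + 20) * 2 ^ k + (16 * (k + 1) * 2 ^ (k + 1) + 1) + (16 * k + 44) * (2 ^ p + 2 ^ q)
      < (16 * p + 9) * 2 ^ p + (16 * q + 9) * 2 ^ q + (16 * k + 44) * (2 ^ k + 2 ^ (k + 1)) := by
  have h1 := u4_le k p
  have h2 := u4_le k q
  have hk : 1 ≤ 2 ^ k := Nat.one_le_two_pow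
  rw [pow_succ]
  nlinarith [h1, h2, hk]

/-- **adjacent target `(k,k+1)` beats every other `a_p c_q` term.** -/
theorem adj_vs_ac (k p q : ℕ) (h : ¬ (p = k ∧ q = k + 1)) :
    (16 * k + 20) * 2 ^ k + (16 * (k + 1) * 2 ^ (k + 1) + 1) + (16 * k + 44) * (2 ^ p + 2 ^ q)
      < (16 * p + 20) * 2 ^ p + (16 * q * 2 ^ q + 1) + (16 * k + 44) * (2 ^ k + 2 ^ (k + 1)) := by
  rw [pow_succ]
  by_cases hp : p = k
  · have hq : q ≠ k + 1 := fun hq => h ⟨hp, hq⟩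
    have h1 := u5_le k p
    have h2 := u6_lt k q hq
    nlinarith [h1, h2]
  · have h1 := u5_lt k p hp
    have h2 := u6_le k q
    nlinarith [h1, h2]

/-- **skip target `(j,j+2)` (slope `16j+51`, `n = A_j + C_{j+2}`, `E = 2^j + 2^{j+2}`) beats every `b_p b_q` term.** -/
theorem skip_vs_bb (j p q : ℕ) :
    (16 * j + 20) * 2 ^ j + (16 * (j + 2) * 2 ^ (j + 2) + 1) + (16 * j + 51) * (2 ^ p + 2 ^ q)
      < (16 * p + 9) * 2 ^ p + (16 * q + 9) * 2 ^ q + (16 * j + 51) * (2 ^ j + 2 ^ (j + 2)) := by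
  have h1 := u7_le j p
  have h2 := u7_le j q
  have hj : 1 ≤ 2 ^ j := Nat.one_le_two_pow
  rw [pow_succ, pow_succ]
  nlinarith [h1, h2, hj]

/-- **skip target `(j,j+2)` beats every other `a_p c_q` term.** -/
theorem skip_vs_ac (j p q : ℕ) (h : ¬ (p = j ∧ q = j + 2)) :
    (16 * j + 20) * 2 ^ j + (16 * (j + 2) * 2 ^ (j + 2) + 1) + (16 * j + 51) * (2 ^ p + 2 ^ q)
      < (16 * p + 20) * 2 ^ p + (16 * q * 2 ^ q + 1) + (16 * j + 51) * (2 ^ j + 2 ^ (j + 2)) := by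
  rw [pow_succ, pow_succ]
  by_cases hp : p = j
  · have hq : q ≠ j + 2 := fun hq => h ⟨hp, hq⟩
    have h1 := u8_le j p
    have h2 := u9_lt j q hq
    nlinarith [h1, h2]
  · have h1 := u8_lt j p hp
    have h2 := u9_le j q
    nlinarith [h1, h2]

/-- **unique minimal term of the diagonal coefficient:** `2B_k < A_k + C_k`. -/
theorem diag_min (k : ℕ) : 2 * ((16 * k + 9) * 2 ^ k) < (16 * k + 20) * 2 ^ k + (16 * k * 2 ^ k + 1) := by
  have hk : 1 ≤ 2 ^ k := Nat.one_le_two_pow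
  nlinarith [hk]

end Summit.ValiantsHypothesis.ValiantsHypothesis.Theorems.KPlusLogSqLaw.ValDoor
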